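import Literature.NumberTheory.FaltingsSerre.ResidualIdentificationOfKernel
import HarnessLib

/-!
# Cited-form instance `N = 461`: `A₄₆₁` paramodular away from `461`, Step 1 by Route T in the kernel

[BPPTVY] = A. Brumer, A. Pacetti, C. Poor, G. Tornaría, J. Voight, D. S. Yuen, *On the paramodularity of
typical abelian surfaces*, Algebra & Number Theory **13**:5 (2019) 1145–1195 [cite: BrumerEtAl2019]
(printed numbering and pages: Alg 2.4.1 p. 1155, Thm 2.1.5 p. 1150, Thm 4.3.4 p. 1169, Prop 4.3.2
p. 1168, (4.1.3) p. 1163, (5.1.8) and Example 5.1.9 p. 1174, Prop 5.2.4 p. 1175, Lemma 7.1.4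
pp. 1187–1188, Thm 7.1.3 p. 1187).  [BPPTVY] contains NO statement about `N = 461`: it treats
`N = 277, 353, 587` only.  The pair here is `A₄₆₁ = Jac(C₄₆₁)`, `C₄₆₁ : y² + x³y = x⁵ − 3x³ + 3x − 2`
(LMFDB genus-2 curve `461.a.461.1` [cite: LMFDB, genus-2 curve 461.a.461.1]; the isogeny class is the
row "461" of [cite: BrumerKramer2014, Table 2 p. 2512]), and `f₄₆₁` = the weight-2 paramodular
nonlift of level `461` with rational eigenvalues of [cite: PoorYuen2015, Thm 1.2 p. 1402; Table 5 p. 1433]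
(printed column `461`: `λ₂ = 0, λ₃ = −3, λ₄ = −3, λ₅ = 1, λ₇ = 0, λ₉ = 2, λ₁₁ = 2`).  Paramodularity of
`A₄₆₁` is NOT a published theorem (as of 2026-08-19); the cell applies the method of
[BPPTVY, Alg 2.4.1, Thm 2.1.5, Thm 4.3.4] to `(A₄₆₁, f₄₆₁)` exactly as `ParamodularCitedInstances.lean`
does for `N = 349`, and — as everywhere in this directory — every datum is a binder and only the
implication is asserted.

PLACEMENT.  A NEW instance theorem (the cell's, not a published one) — by the LEAN PLACEMENT RULE of
2026-08-19 it lives summit-side, `Summits/Langlands/Paramodular/` (cell topic `Paramodular` of the summit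
`Langlands`; namespace `Summit.Langlands.Paramodular.Paramodular461`), and IMPORTS the typed published
method from `Literature/NumberTheory/FaltingsSerre/` (the cited criterion [Thm 2.1.5 / Alg 2.4.1], the
cited form-side fact [Thm 4.3.4 + Lemmas 4.3.6/4.3.8/4.3.10], the templates
`paramodular_of_galoisCertificate_cited` / `ResidualIdentification.of_kernel_of_transvection`, and the
kernel group theory of `ι(S₆) = Sp₄(𝔽₂)`), exactly as the `N = 349` instance
(`ParamodularCitedInstances.lean`, landed before that rule) instantiates them in place.

WHAT THIS FILE IS.  The level `461` on the cited-form template `paramodular_of_galoisCertificate_cited`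
(`ParamodularCited.lean`, cell record `DIVERGENCE.md` D-29) and on its Route-T refinement
(`ResidualIdentification.of_kernel_of_transvection`, `ResidualIdentificationOfKernel.lean`, D-30):
* `checkPrimes461 = {3, 5, 7, 11, 13, 17, 19, 23, 29, 31, 67}` — the check primes `P(461)` of the
  curve-side Galois half (`K₀ = ℚ(rᵢ + rⱼ)` of degree `10`, `dim K₀(S,2) = 12`, `4095` quadratic
  extensions; four runs {A, B group tables} × {A, B field data} agree);
* the binder `G : GaloisCertificate 461 checkPrimes461 cyclotomicMultiplier ρA` (spelled out — no
  `Prop`-valued `def` summit-side, D-0027 §2.1 `tree.vendored-fact`) — the Galois half as ONE `Prop` binder ↔ `certs/461/galois/galois_certificate.canonical.json`, sha256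
  `01ecdd91a93427d9ae6793ffe0d5ecdbabc9de00201e1152a34ced2d32a74f99` (verdict `galois_half: certified`,
  GRH-free, every block by two implementations that agree; image `S₅(b)`: the `2`-division sextic
  `4P + Q² = x⁶ + 4x⁵ − 12x³ + 12x − 8 = (x + 2)·(x⁵ + 2x⁴ − 4x³ − 4x² + 8x − 4)`, core quintic of
  discriminant `2⁸·461`, Galois group `S₅` ×2);
* `typeG_461_at_three` — type (G) for `f₄₆₁` DECIDED at `p₀ = 3` by `typeG_of_ineq` from
  `Q₃(f₄₆₁) = 1 + 3T + 6T² + 9T³ + 9T⁴`, `(a₃, b₃) = (−3, 6)` (`a₃ = λ₃ = −3` printed;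
  `b₃ = λ₃² − λ₉ − 1 = 6` from the printed `λ₉ = 2`; cell: `certs/461/certificate.merged.canonical.json`
  `form_euler.euler_factor_check_small_p` row `p = 3`, impl A + table line, ×2-with-table):
  `9 ≥ 0`, `9 ≤ 48`, `12 ≥ 0`, `108 ≤ 144`;
* `paramodular_461_cited` — conclusion `IsParamodularAwayFrom A 461 f` from the cited fact `h438`, `G`,
  the residual identification datum `hres : ResidualIdentification 461 af bf ρA` (the certificate's
  `residual` block, `certs/461/residual/residual.json`, canonical sha256
  `e0074c0e6fa39bd2721796f641ae7fb27c07fcba52138ae757ca467f1b9c24ac`: all `101` LMFDB candidate fields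
  (`23` quintic, `78` sextic) but `ℚ(core)` excluded at `P_res = [3, 5, 7, 11, 13]` ×2 — the
  exclusions are re-decided in the kernel in `KernelResidualExclusion461.lean`), the data binders and
  type (G);
* `paramodular_461_cited_of_kernel` — the same with `hres` DERIVED by Route T from the kernel
  identification datum `hK`, one inertia element above `461` at which `ρ̄_A` is a transvection (`hi`:
  `ord₄₆₁(disc core) = 1`, so `461`-inertia in `ℚ(A[2])` is generated by a transposition, and
  `ι(S₅(b))` has transvections [Example 5.1.9 p. 1174]), and `Frob₅` of order `5` PRODUCED from
  `L₅(A₄₆₁) = 1 − T + T² − 5T³ + 25T⁴` (`(a₅, b₅) = (1, 1)`, both odd: `charpoly ρ̄_A(Frob₅) = Φ₅`;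
  certificate `curve_euler.L_p_at_Pstar.5`, PARI `hyperellcharpoly` + naive point counts ×2; at `p = 3`
  Route T does not start: `b₃(A₄₆₁) = 6` is even).
The trace table `h5 : ∀ p ∈ checkPrimes461, a_p(A₄₆₁) = a_p(f₄₆₁)` (values
`−3, 1, 0, 2, 1, 1, −1, −3, 2, −4, 5` at `3, …, 31, 67`) and `h2` (`L₂(A₄₆₁) = Q₂(f₄₆₁) = 1 + 2T² + 4T⁴`,
`(a₂, b₂) = (0, 2)`, `b₂ = λ₂² − λ₄ − 1`) are binders like all data; their cell attestation is the merged
certificate `certs/461/certificate.merged.canonical.json` (sha256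
`253fafca39f1f8c472633dea7005e18cf973ce6d6fcaa75ae70e62a3df26680d`, form side ×2 at `P(461) ∖ {67}`)
together with the engineer-2 register `certs/461/eng2_form_p67_461.canonical.json` (sha256
`915447877c40c6053993ab70cbba89f306c899038b7232e4177d82b4c5730c14`: `a₆₇(f₄₆₁) = 5` by impl A and
engine C).  Nothing in the kernel depends on those files: the theorems below are implications.
-/

noncomputable section

namespace Summit.Langlands.Paramodular

open Polynomial IsDedekindDomain Field Equiv
open Literature.NumberTheory.FaltingsSerre Literature.NumberTheory.FaltingsSerre.GSp4F2
  Literature.NumberTheory.GaloisRepresentations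
  Literature.NumberTheory.Automorphic.Paramodular Literature.NumberTheory.Automorphic
  Literature.AlgebraicGeometry.Motives
open scoped NumberField

namespace Paramodular461

/-- The check primes `P(461) = {3, 5, 7, 11, 13, 17, 19, 23, 29, 31, 67}` of the `461` Galois half
(finest-invariant obstruction search on the class-field data of `K₀ = ℚ(rᵢ + rⱼ)`, degree `10`,
`4095` quadratic extensions; runs A/B × A/B agree; `certs/461/galois`, sha256 `01ecdd91…`).
[cite: BrumerEtAl2019, Alg 2.4.1 p. 1155 (the algorithm producing such a set); Thm 2.1.5 p. 1150] -/
def checkPrimes461 : Finset ℕ := {3, 5, 7, 11, 13, 17, 19, 23, 29, 31, 67}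

/-- Data check: eleven check primes, `67` the largest, `37`, `41`, `43`, `47`, `53`, `59`, `61` absent.
[cite: BrumerEtAl2019, Alg 2.4.1 p. 1155] -/
theorem checkPrimes461_card : checkPrimes461.card = 11 ∧ 67 ∈ checkPrimes461 ∧ 37 ∉ checkPrimes461 ∧
    43 ∉ checkPrimes461 ∧ 61 ∉ checkPrimes461 := by
  simp [checkPrimes461]

/-- Every check prime is an odd prime different from `461`. [cite: BrumerEtAl2019, Alg 2.4.1 p. 1155] -/
theorem checkPrimes461_good : ∀ p ∈ checkPrimes461, p.Prime ∧ ¬ p ∣ 461 ∧ p ≠ 2 := by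
  decide

/-- Type (G) for `f₄₆₁` at `3`, decided from `Q₃(f₄₆₁) = 1 + 3T + 6T² + 9T³ + 9T⁴`, `(a₃, b₃) = (−3, 6)`:
`0 ≤ 9 − 24 + 24`, `9 ≤ 48`, `0 ≤ 6 + 6`, `4·9·3 = 108 ≤ 144 = 12²`.
[cite: BrumerEtAl2019, Prop 4.3.2 p. 1168; Thm 4.3.4 p. 1169] [cite: MaisnerNart2002, Lemma 2.1 p. 323] -/
theorem typeG_461_at_three (af bf : ℕ → ℤ) (hf3 : af 3 = -3 ∧ bf 3 = 6) :
    ∃ p : ℕ, p.Prime ∧ ¬ p ∣ 461 ∧ ∀ z : ℂ,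
      ((lPolynomialOfSurface p (af p) (bf p)).map (Int.castRingHom ℂ)).IsRoot z →
        ‖z‖ = (Real.sqrt p)⁻¹ :=
  exists_typeG_of_ineq (N := 461) (p₀ := 3) (by norm_num) (by norm_num) af bf
    (by rw [hf3.1, hf3.2]; norm_num) (by rw [hf3.1]; norm_num) (by rw [hf3.2]; norm_num)
    (by rw [hf3.1, hf3.2]; norm_num)

/-- **`A₄₆₁` is paramodular of level `461` away from `461`, with the form side cited** — NOT a printed
theorem: the method of [BPPTVY, Alg 2.4.1 + Thm 2.1.5 + Thm 4.3.4] applied to `(A₄₆₁, f₄₆₁)`,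
conclusion in the shape of [Thm 7.1.3] restricted to `p ≠ 461`, GIVEN the binders.
`paramodular_of_galoisCertificate_cited` at `N = 461`, `T = checkPrimes461` (`checkPrimes461_good`).
Binders: `h438` (the cited form-side fact, ARTHUR-DEPENDENT); `G : GaloisCertificate 461 checkPrimes461
cyclotomicMultiplier ρA` (the curve-side Galois half: `similitude` for `J = antiIdAlt4 ℤ_[2]` and multiplier
`cyclotomicMultiplier` [(4.1.3)], `absIrreducible` (image `S₅(b)`), `complete` (the obstruction claim on
`checkPrimes461`) ↔ `certs/461/galois/galois_certificate.canonical.json`, sha256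
`01ecdd91a93427d9ae6793ffe0d5ecdbabc9de00201e1152a34ced2d32a74f99`);
`hframe`; `aA bA af bf` with `hA` (good Euler factors of `A`), `hfe` (spinor Euler factors of `f`);
`hres` the residual identification datum (`residual` block, canonical sha256 `e0074c0e…`); `h5` the
trace table on `checkPrimes461`; `hcusp`, `hne`; `hf3 : (a₃, b₃)(f₄₆₁) = (−3, 6)` (type (G) at `3`);
`h2` (`L₂ = Q₂ = 1 + 2T² + 4T⁴`).
[cite: BrumerEtAl2019, Thm 7.1.3 p. 1187 (shape of the statement only); Lemma 7.1.4 p. 1187; p. 1188; Thm 4.3.4 p. 1169; Alg 2.4.1 p. 1155; (4.1.3) p. 1163; Lemma 5.1.7 p. 1173] -/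
theorem paramodular_461_cited
    {A : AbelianVariety ℚ} {f : Matrix (Fin 2) (Fin 2) ℂ → ℂ} {ρA : FramedGaloisRep ℚ ℤ_[2] 4}
    {b : Module.Basis (Fin 4) ℚ_[2] (A.rationalTateModule 2)}
    (h438 : BrumerEtAl2019.existsIntegralSymplecticGaloisRep_two_primeLevel)
    (G : GaloisCertificate 461 checkPrimes461 cyclotomicMultiplier ρA)
    (hframe : A.IsFrameOfTateRep 2 b (rationalize ρA)) (aA bA af bf : ℕ → ℤ)
    (hres : ResidualIdentification 461 af bf ρA)
    (hA : ∀ p : ℕ, p.Prime → ¬ p ∣ 461 →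
      A.HasGoodEulerFactorAt p ((lPolynomialOfSurface p (aA p) (bA p)).map (Int.castRingHom ℚ)))
    (h5 : ∀ p ∈ checkPrimes461, aA p = af p)
    (hcusp : IsParamodularCuspForm 461 2 f) (hne : ∃ Z ∈ siegelUpperHalfSpace 2, f Z ≠ 0)
    (hfe : ∀ p : ℕ, p.Prime → ¬ p ∣ 461 →
      HasSpinorEulerFactorAt 2 p f ((lPolynomialOfSurface p (af p) (bf p)).map (Int.castRingHom ℂ)))
    (hf3 : af 3 = -3 ∧ bf 3 = 6) (h2 : aA 2 = af 2 ∧ bA 2 = bf 2) :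
    IsParamodularAwayFrom A 461 f :=
  haveI : Fact (Nat.Prime 461) := ⟨by norm_num⟩
  paramodular_of_galoisCertificate_cited (by norm_num) h438 G hframe aA bA af bf hres hA
    checkPrimes461_good h5 hcusp hne hfe (typeG_461_at_three af bf hf3) h2

/-- **`A₄₆₁` paramodular away from `461` (NOT a printed theorem — the method of [BPPTVY] applied to
`(A₄₆₁, f₄₆₁)`) with the form side cited and Step 1 (R) in the kernel.**  `paramodular_461_cited` with
`hres` DERIVED by Route T (`ResidualIdentification.of_kernel_of_transvection`) from
`hK : KernelIdentification 461 af bf ρA` (part (F): the `residual` block's candidate-field enumeration,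
`101` fields, all but `ℚ(core)` excluded ×2 — `KernelResidualExclusion461.lean` re-decides the
exclusions), `hi` (a transvection in `ρ̄_A` of inertia above `461`: the core quintic
`x⁵ + 2x⁴ − 4x³ − 4x² + 8x − 4` has discriminant `2⁸·461`, `ord₄₆₁ = 1`, so `461`-inertia in `ℚ(A[2])`
is generated by a transposition; `ι(S₅(b))` has transvections), and `Frob₅` of order `5` PRODUCED from
`L₅(A₄₆₁) = 1 − T + T² − 5T³ + 25T⁴` (`hA5 : (a₅, b₅)(A₄₆₁) = (1, 1)`, odd/odd, so
`charpoly ρ̄_A(Frob₅) = Φ₅`; `exists_orderFive_of_eulerData`).  At `p = 3` the route does not start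
(`b₃(A₄₆₁) = 6` even), which is why the Frobenius datum sits at `5` and type (G) at `3`.
[cite: BrumerEtAl2019, Alg 2.4.1 p. 1155; Lemma 7.1.4 pp. 1187–1188 (method); (5.1.8) p. 1174; Example 5.1.9 p. 1174; Prop 5.2.4 p. 1175] -/
theorem paramodular_461_cited_of_kernel
    {A : AbelianVariety ℚ} {f : Matrix (Fin 2) (Fin 2) ℂ → ℂ} {ρA : FramedGaloisRep ℚ ℤ_[2] 4}
    {b : Module.Basis (Fin 4) ℚ_[2] (A.rationalTateModule 2)}
    (h438 : BrumerEtAl2019.existsIntegralSymplecticGaloisRep_two_primeLevel)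
    (G : GaloisCertificate 461 checkPrimes461 cyclotomicMultiplier ρA)
    (hframe : A.IsFrameOfTateRep 2 b (rationalize ρA)) (aA bA af bf : ℕ → ℤ)
    (hK : KernelIdentification 461 af bf ρA)
    (hi : ∃ v : HeightOneSpectrum (𝓞 ℚ), ((461 : ℕ) : 𝓞 ℚ) ∈ v.asIdeal ∧ ∃ 𝔓 ∈ v.primesAbove,
      ∃ τ ∈ 𝔓.inertia (absoluteGaloisGroup ℚ),
        IsTransvection ((residual ρA.toMonoidHom τ : GL (Fin 4) (ZMod 2)) :
          Matrix (Fin 4) (Fin 4) (ZMod 2)))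
    (hA : ∀ p : ℕ, p.Prime → ¬ p ∣ 461 →
      A.HasGoodEulerFactorAt p ((lPolynomialOfSurface p (aA p) (bA p)).map (Int.castRingHom ℚ)))
    (hA5 : aA 5 = 1 ∧ bA 5 = 1)
    (h5 : ∀ p ∈ checkPrimes461, aA p = af p)
    (hcusp : IsParamodularCuspForm 461 2 f) (hne : ∃ Z ∈ siegelUpperHalfSpace 2, f Z ≠ 0)
    (hfe : ∀ p : ℕ, p.Prime → ¬ p ∣ 461 →
      HasSpinorEulerFactorAt 2 p f ((lPolynomialOfSurface p (af p) (bf p)).map (Int.castRingHom ℂ)))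
    (hf3 : af 3 = -3 ∧ bf 3 = 6) (h2 : aA 2 = af 2 ∧ bA 2 = bf 2) :
    IsParamodularAwayFrom A 461 f := by
  have ha5 : Odd (aA 5) := by rw [hA5.1]; exact odd_one
  have hb5 : Odd (bA 5) := by rw [hA5.2]; exact odd_one
  obtain ⟨c, hc5, hc1⟩ := exists_orderFive_of_eulerData hframe (q := 5) (by norm_num) (by norm_num)
    (hA 5 (by norm_num) (by norm_num)) ha5 hb5
  exact paramodular_461_cited h438 G hframe aA bA af bf
    (ResidualIdentification.of_kernel_of_transvection
      (range_residual_le_iotaGL_framed ρA cyclotomicMultiplier G.similitude) hK hc5 hc1 hi)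
    hA h5 hcusp hne hfe hf3 h2

/-- Non-vacuity of the numeric side conditions: the four type-(G) inequalities at `(p, a, b) = (3, −3, 6)`
and the parities at `(a₅, b₅) = (1, 1)`. [cite: BrumerEtAl2019, Prop 4.3.2 p. 1168; (5.1.8) p. 1174] -/
example : (0 : ℤ) ≤ (-3) ^ 2 - 4 * 6 + 8 * 3 ∧ ((-3 : ℤ)) ^ 2 ≤ 16 * 3 ∧ (0 : ℤ) ≤ 2 * 3 + 6 ∧
    4 * ((-3 : ℤ)) ^ 2 * 3 ≤ (2 * 3 + 6) ^ 2 ∧ Odd (1 : ℤ) := by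
  refine ⟨by norm_num, by norm_num, by norm_num, by norm_num, odd_one⟩

end Paramodular461

end Summit.Langlands.Paramodular

end
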